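import Summits.Ventures.PercRepro.C041TreeZoneNode

/-!
# ROW C-041 — the zone sets of a NODE in terms of its children (p6, gen 29; C-041.md §15 (c), (i), §19 (h))

Setting of `C041TreeZoneNode`: the node zone `nodeZone Zc rc p q` with its root `none`, a state `σ` and its
restrictions `restrict σ j` to the children.  From the reach characterisations of that module: the anchor's sub-zone
`P {none}` and its red reach `K {none}` at a child vertex (`some_mem_P_iff`, `some_mem_K_iff`), the deleted vertices
`D` and `D2` at the root and at a child vertex (`none_mem_D_iff`, `some_mem_D_iff`, `none_mem_D2_iff`,
`some_mem_D2_iff`), relative admissibility of the node (`admR_node_iff`: a child on a red edge is admissible as a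
whole, a child on a blue edge relatively) and «blue at `K`» (`blueK_node_iff`: no red mark at the root, every child
on a red edge blue at its own `K`) — exactly the recursions of mine-3's predicates `rb1` / `rb2` / `admR` / `adm` /
`redK` on `TZ.St` (`C041TreeStates`).  The bridge to `TZ` is the next module.
-/

namespace PercRepro

namespace ZoneZ

namespace TreeNode

open ZoneData

universe u₁ u₂ u₃ u₄

variable {d : ℕ} {Vc : Fin d → Type u₁} {Ec : Fin d → Type u₂} {T₁c : Fin d → Type u₃} {T₂c : Fin d → Type u₄}
variable (Zc : ∀ j, ZoneData (Vc j) (Ec j) (T₁c j) (T₂c j)) (rc : ∀ j, Vc j) {p q : ℕ}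
  (σ : State (NEdge Ec) (NMark p T₁c) (NMark q T₂c))

/-! ## The zone sets of the node -/

/-- The anchor's sub-zone at a child vertex. -/
theorem some_mem_P_iff (j : Fin d) (x : Vc j) :
    (some ⟨j, x⟩ : NPos Vc) ∈ (nodeZone Zc rc p q).P {none} σ ↔
      σ.1 ⟨j, none⟩ = false ∧ x ∈ (Zc j).P {rc j} (restrict σ j) :=
  some_mem_reach_singleton_none_iff Zc rc σ false j x

/-- The red reach of the anchor at a child vertex. -/
theorem some_mem_K_iff (j : Fin d) (x : Vc j) :
    (some ⟨j, x⟩ : NPos Vc) ∈ (nodeZone Zc rc p q).K {none} σ ↔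
      σ.1 ⟨j, none⟩ = true ∧ x ∈ (Zc j).K {rc j} (restrict σ j) :=
  some_mem_reach_singleton_none_iff Zc rc σ true j x

/-- The child's part of the blockers. -/
theorem childSet_Bl (j : Fin d) : childSet ((nodeZone Zc rc p q).Bl σ) j = (Zc j).Bl (restrict σ j) := by
  ext x
  exact some_mem_Bl_iff Zc rc σ j x

/-- The child's part of the `2`-blockers. -/
theorem childSet_M (j : Fin d) : childSet ((nodeZone Zc rc p q).M σ) j = (Zc j).M (restrict σ j) := by
  ext x
  exact some_mem_M_iff Zc rc σ j x

/-- **The root is deleted** iff it carries a blue `1`-mark or a blue edge leads to a deleted child root. -/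
theorem none_mem_D_iff :
    (none : NPos Vc) ∈ (nodeZone Zc rc p q).D σ ↔
      (∃ i, σ.2.1 (Sum.inl i) = false) ∨ ∃ j, σ.1 ⟨j, none⟩ = false ∧ rc j ∈ (Zc j).D (restrict σ j) := by
  unfold D BlueAdj
  rw [none_mem_reach_iff, rootReach, none_mem_Bl_iff]
  refine or_congr Iff.rfl (exists_congr fun j => and_congr Iff.rfl ?_)
  rw [childSet_Bl]

/-- **A child vertex is deleted** iff it is deleted inside its child, or its edge is blue, it lies in the child's
anchor sub-zone and the root is deleted. -/
theorem some_mem_D_iff (j : Fin d) (x : Vc j) :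
    (some ⟨j, x⟩ : NPos Vc) ∈ (nodeZone Zc rc p q).D σ ↔
      x ∈ (Zc j).D (restrict σ j) ∨
        (σ.1 ⟨j, none⟩ = false ∧ x ∈ (Zc j).P {rc j} (restrict σ j) ∧ (none : NPos Vc) ∈ (nodeZone Zc rc p q).D σ) := by
  unfold D P BlueAdj
  rw [some_mem_reach_iff, none_mem_reach_iff, childSet_Bl]

/-- **The root is deleted on side `2`** iff it carries a blue `2`-mark or a blue edge leads to a child root deleted
on side `2`. -/
theorem none_mem_D2_iff :
    (none : NPos Vc) ∈ (nodeZone Zc rc p q).D2 σ ↔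
      (∃ i, σ.2.2 (Sum.inl i) = false) ∨ ∃ j, σ.1 ⟨j, none⟩ = false ∧ rc j ∈ (Zc j).D2 (restrict σ j) := by
  unfold D2 BlueAdj
  rw [none_mem_reach_iff, rootReach, none_mem_M_iff]
  refine or_congr Iff.rfl (exists_congr fun j => and_congr Iff.rfl ?_)
  rw [childSet_M]

/-- **A child vertex is deleted on side `2`** iff it is so inside its child, or its edge is blue, it lies in the
child's anchor sub-zone and the root is deleted on side `2`. -/
theorem some_mem_D2_iff (j : Fin d) (x : Vc j) :
    (some ⟨j, x⟩ : NPos Vc) ∈ (nodeZone Zc rc p q).D2 σ ↔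
      x ∈ (Zc j).D2 (restrict σ j) ∨
        (σ.1 ⟨j, none⟩ = false ∧ x ∈ (Zc j).P {rc j} (restrict σ j) ∧
          (none : NPos Vc) ∈ (nodeZone Zc rc p q).D2 σ) := by
  unfold D2 P BlueAdj
  rw [some_mem_reach_iff, none_mem_reach_iff, childSet_M]

/-- **Relative admissibility of the node**: a child on a red edge is admissible as a whole, a child on a blue edge
is relatively admissible (beyond its root sub-zone, which merges with the anchor's). -/
theorem admR_node_iff :
    (nodeZone Zc rc p q).admR none σ ↔ ∀ j,
      (σ.1 ⟨j, none⟩ = true → (Zc j).admR (rc j) (restrict σ j) ∧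
        ¬ (rc j ∈ (Zc j).D (restrict σ j) ∧ rc j ∈ (Zc j).D2 (restrict σ j))) ∧
      (σ.1 ⟨j, none⟩ = false → (Zc j).admR (rc j) (restrict σ j)) := by
  constructor
  · intro h j
    constructor
    · intro hred
      rw [← adm_iff_admR, adm, Set.disjoint_left]
      intro x hx hxD
      have hP : (some ⟨j, x⟩ : NPos Vc) ∉ (nodeZone Zc rc p q).P {none} σ := by
        rw [some_mem_P_iff]
        rintro ⟨hb, -⟩
        rw [hred] at hb
        exact Bool.noConfusion hb
      exact h _ ((some_mem_M_iff Zc rc σ j x).2 hx) hP ((some_mem_D_iff Zc rc σ j x).2 (Or.inl hxD))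
    · intro hblue x hx hxP hxD
      have hP : (some ⟨j, x⟩ : NPos Vc) ∉ (nodeZone Zc rc p q).P {none} σ := by
        rw [some_mem_P_iff]
        rintro ⟨-, hxP'⟩
        exact hxP hxP'
      exact h _ ((some_mem_M_iff Zc rc σ j x).2 hx) hP ((some_mem_D_iff Zc rc σ j x).2 (Or.inl hxD))
  · intro h m hm hmP hmD
    rcases m with _ | ⟨j, x⟩
    · exact hmP (mem_reach_of_mem rfl)
    · rw [some_mem_M_iff] at hm
      rw [some_mem_P_iff] at hmP
      rw [some_mem_D_iff] at hmD
      rcases hmD with hmD | ⟨hb, hxP, -⟩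
      · cases hc : σ.1 ⟨j, none⟩
        · exact (h j).2 hc x hm (fun hxP => hmP ⟨hc, hxP⟩) hmD
        · have hadm := (adm_iff_admR (Zc j) (rc j) (restrict σ j)).2 ((h j).1 hc)
          exact Set.disjoint_left.1 hadm hm hmD
      · exact hmP ⟨hb, hxP⟩

/-- **Blue at `K` on the node**: no red mark at the root, and every child on a red edge is blue at its own `K`. -/
theorem blueK_node_iff :
    (nodeZone Zc rc p q).blueK {none} σ ↔
      ¬ (∃ i, σ.2.1 (Sum.inl i) = true) ∧ ¬ (∃ i, σ.2.2 (Sum.inl i) = true) ∧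
        ∀ j, σ.1 ⟨j, none⟩ = true → (Zc j).blueK {rc j} (restrict σ j) := by
  unfold blueK
  rw [Set.disjoint_left]
  constructor
  · intro h
    refine ⟨fun h1 => h (mem_reach_of_mem rfl) (Or.inl ((none_mem_Blt_iff Zc rc σ).2 h1)),
      fun h2 => h (mem_reach_of_mem rfl) (Or.inr ((none_mem_Mt_iff Zc rc σ).2 h2)), fun j hred => ?_⟩
    rw [Set.disjoint_left]
    intro x hxK hxM
    refine h ((some_mem_K_iff Zc rc σ j x).2 ⟨hred, hxK⟩) ?_
    rcases hxM with h1 | h2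
    · exact Or.inl ((some_mem_Blt_iff Zc rc σ j x).2 h1)
    · exact Or.inr ((some_mem_Mt_iff Zc rc σ j x).2 h2)
  · rintro ⟨h1, h2, h3⟩ v hvK hvM
    rcases v with _ | ⟨j, x⟩
    · rcases hvM with hv | hv
      · exact h1 ((none_mem_Blt_iff Zc rc σ).1 hv)
      · exact h2 ((none_mem_Mt_iff Zc rc σ).1 hv)
    · obtain ⟨hred, hxK⟩ := (some_mem_K_iff Zc rc σ j x).1 hvK
      refine Set.disjoint_left.1 (h3 j hred) hxK ?_
      rcases hvM with hv | hv
      · exact Or.inl ((some_mem_Blt_iff Zc rc σ j x).1 hv)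
      · exact Or.inr ((some_mem_Mt_iff Zc rc σ j x).1 hv)

end TreeNode

end ZoneZ

end PercRepro
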